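import Literature.Analysis.FluidPDE.TorusNSStrainDirectionCriterion
import HarnessLib

/-!
# Miller's locally anisotropic regularity criterion in terms of the vorticity (PAMS B 8 (2021)),
# on `T³`, continuation form

search for candidate a priori estimates; no regularity claim.

Analysis/FluidPDE proof file (theorems only; no definitions, no named facts). E. Miller,
*A locally anisotropic regularity criterion for the Navier–Stokes equation in terms of vorticity*,
Proc. Amer. Math. Soc. Ser. B 8 (2021) (arXiv:2002.02152), Thm 1.6 = Thm 2.1: *suppose `u` is a
mild solution, `v ∈ L^∞(ℝ³ × [0,∞); ℝ³)` with `|v(x,t)| = 1` a.e. and `∇v ∈ L^∞_loc L^∞_x`. Then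
`‖u(t)‖²_{Ḣ¹} ≤ ‖u⁰‖²_{Ḣ¹} exp(2916 C₂‖u⁰‖⁴_{L²}‖∇v‖²_{L^∞_tL^∞_x} + (C₂/8)∫₀ᵗ‖v × ω‖⁴_{L²})`; in
particular if `T_max < ∞` then `∫₀^{T_max} ‖v × ω‖⁴_{L²} = +∞`* — "the vorticity [must] blow up
in every plane, where the plane may vary in space and time so long as the gradient of the vector
orthogonal to the plane remains bounded"; the two extreme cases are Chae–Choe (`v` constant) and
(qualitatively) Beirão da Veiga–Berselli (`v = ω/|ω|`).

The printed proof (§2) is followed: pointwise `Sv = ½(∇u)v + ½(∇u)ᵀv`, `½ v × ω = Av =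
½(∇u)v − ½(∇u)ᵀv`, hence (step3) `‖Sv‖²_{L²} = ¼‖v × ω‖²_{L²} + ⟨(∇u)v, (∇u)ᵀv⟩`; integration
by parts with `∇·u = 0` gives `⟨(∇u)v, (∇u)ᵀv⟩ = −∑∫ uⱼ∂ₖuᵢ(vₖ∂ᵢvⱼ + vⱼ∂ᵢvₖ) ≤ 54‖u‖₂‖∇u‖₂‖∇v‖_∞`;
the energy equality bounds `∫₀ᵗ‖u‖₂²‖∇u‖₂²`; and "Corollary (StrainAllDirections)" — Miller's
strain-in-every-direction criterion at `q = 2`, `p = 4`, here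
`Torus.exists_enstrophyFlux_le_of_strainDirection_Lq_le` / the Grönwall door — concludes.

* `AnisotropicVorticity.integral_strainDirection_sq_le` — (step3) + the IBP estimate on `T^d`,
  `card d = 3`: for smooth divergence-free `u` and a smooth unit field `w` with `‖∂ᵢw‖ ≤ D`,
  `∫|S w|² ≤ ∫|A w|² + 54 D ‖u‖₂ ‖∇u‖₂`, where `(Aw)ᵢ = ∑ⱼ ½((∂ⱼu)ᵢ − (∂ᵢu)ⱼ) wⱼ`
  (`|Aw| = ½|w × ω|` in three dimensions).
* `Torus.classicalNS_continuation_of_anisotropicVorticity_sq_integral_le` — **Thm 1.6 on `T³`,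
  continuation form**: a classical mean-zero solution on `[0, T) × T^d`, a family of smooth unit
  fields `w(t, ·)` with `‖∂ᵢw(t,x)‖ ≤ D`, a continuous `N` with `‖A(t)w(t)‖_{L²} ≤ N(t)`
  (i.e. `½‖w × ω‖_{L²} ≤ N`) and `∫₀ᵗ N⁴ ≤ I` on `[0, T)` ⇒ continuation past `T`.
* `AnisotropicVorticity.four_mul_sum_antisymDirection_sq_eq` (pointwise `4|Aw|² = |ω × w|²` on
  `T³ = UnitAddTorus (Fin 3)`, `ω = BDSV.curl u`) and
  `Torus.classicalNS_continuation_of_crossProduct_vorticity_sq_integral_le` — the same theorem on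
  `UnitAddTorus (Fin 3)` with the hypothesis written as printed, `‖w(t) × ω(t)‖²_{L²} ≤ 4N(t)²`.

Scope (faithfulness): classical solutions with mean-zero slices on `T^d`, `card d = 3`, `ν > 0`,
unforced; `w(t,·)` smooth in `x` for each `t` (no regularity in `t` is needed: only the continuous
majorant `N` enters), `|w| = 1` everywhere; the hypothesis is on `‖Aw‖_{L²} = ½‖w × ω‖_{L²}` written
without the cross product (general index type `d`); constants inexplicit (Miller: `2916 C₂`,
`C₂/8`). -- TODO(general form): forcing; the whole-space mild-solution setting.

## Mathlib / tree search

Reused: `Torus.exists_enstrophyFlux_le_of_strainDirection_Lq_le`,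
`Torus.classicalNS_continuation_of_enstrophyFlux_le`, `Torus.IsClassicalNSSolutionOn.energy_eq`,
`Torus.IsSmoothSpaceTimeOn.continuousOn_gradNormSq`, `Torus.partialDeriv_mul/comm/finset_sum`,
`Torus.partialDeriv_apply_coord`, `Torus.integral_partialDeriv_eq_zero_holds`,
`Torus.divergence_eq_sum_partialDeriv_apply`. Searched CRITERIA.md §A and
`lean search 'anisotropic|crossProduct.*curl'`: the criterion is in neither (the tree's
`TorusAnisotropicLadyzhenskaya` is an unrelated inequality).

## References

* E. Miller, *A locally anisotropic regularity criterion for the Navier–Stokes equation in terms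
  of vorticity*, Proc. Amer. Math. Soc. Ser. B 8 (2021), doi:10.1090/bproc/74, arXiv:2002.02152 —
  Thm 1.6 = Thm 2.1 and its proof (§2) (held: paper:arxiv-2002.02152, pp. 5, 8). [Miller2021Anisotropic]
* E. Miller, Arch. Ration. Mech. Anal. 235 (2020) 99–139, Thm 1.3 / Cor 5.8
  ("StrainAllDirections"). [Miller2019]
* D. Chae, H.-J. Choe, Electron. J. Differential Equations 1999/05, Thm 1. [ChaeChoe1999]
-/

noncomputable section

open Set MeasureTheory intervalIntegral Filter Real Matrix
open scoped InnerProductSpace RealInnerProductSpace Topology ENNReal NNReal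

namespace Literature.Analysis.FluidPDE

open Literature.Analysis.FunctionSpaces

variable {d : Type*} [Fintype d] [DecidableEq d]

namespace AnisotropicVorticity

/-! ## §1 Calculus helpers on `T^d` -/

/-- Integration by parts for smooth scalar functions on the torus:
`∫ (∂ᵢf) g = −∫ f ∂ᵢg`. [folklore] -/
private theorem integral_partialDeriv_mul_eq_neg {f g : UnitAddTorus d → ℝ} (hf : Torus.IsSmooth f)
    (hg : Torus.IsSmooth g) (i : d) :
    ∫ x, Torus.partialDeriv i f x * g x = -∫ x, f x * Torus.partialDeriv i g x := by
  have hfg : Torus.IsSmooth (fun x => f x * g x) := hf.mul hg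
  have h0 : ∫ x, Torus.partialDeriv i (fun y => f y * g y) x = 0 :=
    Torus.integral_partialDeriv_eq_zero_holds hfg i
  have hprod : ∀ x, Torus.partialDeriv i (fun y => f y * g y) x =
      f x * Torus.partialDeriv i g x + Torus.partialDeriv i f x * g x :=
    fun x => Torus.partialDeriv_mul (hf.isContDiff (by simp)) (hg.isContDiff (by simp)) i x
  simp_rw [hprod] at h0
  have h1 : Torus.IsSmooth (fun y => f y * Torus.partialDeriv i g y) := hf.mul (hg.partialDeriv i)
  have h2 : Torus.IsSmooth (fun y => Torus.partialDeriv i f y * g y) := (hf.partialDeriv i).mul hg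
  rw [MeasureTheory.integral_add h1.continuous.integrable_unitAddTorus
    h2.continuous.integrable_unitAddTorus] at h0
  linarith

omit [Fintype d] in
/-- The partial derivative of the zero function vanishes. [folklore] -/
private theorem partialDeriv_zero_fun (i : d) (x : UnitAddTorus d) :
    Torus.partialDeriv i (fun _ : UnitAddTorus d => (0 : ℝ)) x = 0 := by
  simp [Torus.partialDeriv, Torus.lineDeriv]

/-- `∑ᵢ ∂ᵢ∂ⱼuᵢ = ∂ⱼ(div u) = 0` for smooth divergence-free `u`. [folklore] -/
private theorem sum_partialDeriv_partialDeriv_apply_eq_zero {u : UnitAddTorus d → EuclideanSpace ℝ d}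
    (hu : Torus.IsSmooth u) (hdiv : Torus.IsDivFree u) (j : d) (x : UnitAddTorus d) :
    ∑ i, Torus.partialDeriv i (fun y => Torus.partialDeriv j u y i) x = 0 := by
  have h1 : ∀ i, Torus.partialDeriv i (fun y => Torus.partialDeriv j u y i) x =
      Torus.partialDeriv j (fun y => Torus.partialDeriv i u y i) x := by
    intro i
    rw [Torus.partialDeriv_apply_coord ((hu.partialDeriv j).isContDiff (by simp)) i x i,
      Torus.partialDeriv_comm hu i j x,
      ← Torus.partialDeriv_apply_coord ((hu.partialDeriv i).isContDiff (by simp)) j x i]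
  simp only [h1]
  rw [← Torus.partialDeriv_finset_sum Finset.univ
    (fun i _ => ((hu.partialDeriv i).apply i).isContDiff (by simp)) j x]
  have hfun : (fun y => ∑ i ∈ Finset.univ, Torus.partialDeriv i u y i) = fun _ => (0 : ℝ) := by
    funext y
    rw [← Torus.divergence_eq_sum_partialDeriv_apply (hu.isContDiff (by simp)) y]
    exact hdiv y
  rw [hfun]
  exact partialDeriv_zero_fun j x

omit [DecidableEq d] in
/-- Cauchy–Schwarz for continuous nonnegative functions on `T^d`. [folklore] -/
private theorem integral_mul_le_sqrt_mul_sqrt {f g : UnitAddTorus d → ℝ} (hf : Continuous f)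
    (hg : Continuous g) (hf0 : ∀ x, 0 ≤ f x) (hg0 : ∀ x, 0 ≤ g x) :
    ∫ x, f x * g x ≤ Real.sqrt (∫ x, f x ^ 2) * Real.sqrt (∫ x, g x ^ 2) := by
  have h := integral_mul_le_Lp_mul_Lq_of_nonneg (μ := volume) Real.HolderConjugate.two_two
    (ae_of_all _ hf0) (ae_of_all _ hg0)
    (hf.memLp_of_hasCompactSupport (HasCompactSupport.of_compactSpace f))
    (hg.memLp_of_hasCompactSupport (HasCompactSupport.of_compactSpace g))
  simp only [Real.sqrt_eq_rpow]
  convert h using 3 <;> norm_num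

/-! ## §2 (step3) and the integration by parts estimate -/

/-- **Miller 2021, proof of Thm 2.1, (step1)–(step3) and the integration-by-parts estimate, on
`T^d`** (`card d = 3`): for a smooth divergence-free `u` and a smooth field of unit vectors `w`
with `‖∂ᵢw(x)‖ ≤ D`, writing `(Sw)ᵢ = ∑ⱼ ½((∂ⱼu)ᵢ + (∂ᵢu)ⱼ)wⱼ` and
`(Aw)ᵢ = ∑ⱼ ½((∂ⱼu)ᵢ − (∂ᵢu)ⱼ)wⱼ` (`= ½(ω × w)ᵢ` in three dimensions):
`∫ |Sw|² ≤ ∫ |Aw|² + 54 D ‖u‖_{L²} ‖∇u‖_{L²}` (printed: "`‖Sv‖²_{L²} = ¼‖v × ω‖²_{L²} +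
⟨(∇u)v, (∇u)ᵀv⟩`", "`⟨(∇u)v,(∇u)ᵀv⟩ = −∑ᵢⱼₖ∫ uⱼ∂ₖuᵢ(vₖ∂ᵢvⱼ + vⱼ∂ᵢvₖ) ≤ 54‖u‖_{L²}‖∇u‖_{L²}‖∇v‖_{L^∞}`").
[cite: Miller2021Anisotropic, Thm 2.1 (proof, displays (step1)–(step3) and the IBP estimate)] -/
theorem integral_strainDirection_sq_le (hd : Fintype.card d = 3)
    {u w : UnitAddTorus d → EuclideanSpace ℝ d} (hu : Torus.IsSmooth u) (hdiv : Torus.IsDivFree u)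
    (hw : Torus.IsSmooth w) (hw1 : ∀ x, ‖w x‖ = 1) {D : ℝ}
    (hD : ∀ x i, ‖Torus.partialDeriv i w x‖ ≤ D) :
    ∫ x, ∑ i, (∑ j, (Torus.partialDeriv j u x i + Torus.partialDeriv i u x j) / 2 * w x j) ^ 2 ≤
      (∫ x, ∑ i, (∑ j, (Torus.partialDeriv j u x i - Torus.partialDeriv i u x j) / 2 * w x j) ^ 2) +
        54 * D * Real.sqrt (∫ x, ‖u x‖ ^ 2) * Real.sqrt (Torus.gradNormSq u) := by
  -- notation: `a i x = ∑ⱼ (∂ⱼu)ᵢ wⱼ`, `b i x = ∑ⱼ (∂ᵢu)ⱼ wⱼ`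
  set a : d → UnitAddTorus d → ℝ := fun i x => ∑ j, Torus.partialDeriv j u x i * w x j with ha
  set b : d → UnitAddTorus d → ℝ := fun i x => ∑ j, Torus.partialDeriv i u x j * w x j with hb
  have hDc : ∀ i j, Continuous fun x => Torus.partialDeriv j u x i :=
    fun i j => ((hu.partialDeriv j).apply i).continuous
  have hwc : ∀ j, Continuous fun x => w x j := fun j => (hw.apply j).continuous
  have hac : ∀ i, Continuous (a i) := fun i =>
    continuous_finsetSum _ fun j _ => (hDc i j).mul (hwc j)
  have hbc : ∀ i, Continuous (b i) := fun i =>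
    continuous_finsetSum _ fun j _ => (hDc j i).mul (hwc j)
  -- pointwise (step3): `|Sw|² = |Aw|² + ∑ᵢ aᵢ bᵢ`
  have hS : ∀ x i, ∑ j, (Torus.partialDeriv j u x i + Torus.partialDeriv i u x j) / 2 * w x j =
      (a i x + b i x) / 2 := by
    intro x i
    simp only [ha, hb, ← Finset.sum_add_distrib, Finset.sum_div]
    exact Finset.sum_congr rfl fun j _ => by ring
  have hA : ∀ x i, ∑ j, (Torus.partialDeriv j u x i - Torus.partialDeriv i u x j) / 2 * w x j =
      (a i x - b i x) / 2 := by
    intro x i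
    simp only [ha, hb, ← Finset.sum_sub_distrib, Finset.sum_div]
    exact Finset.sum_congr rfl fun j _ => by ring
  have hpt : ∀ x, ∑ i, (∑ j, (Torus.partialDeriv j u x i + Torus.partialDeriv i u x j) / 2 * w x j) ^ 2 =
      (∑ i, (∑ j, (Torus.partialDeriv j u x i - Torus.partialDeriv i u x j) / 2 * w x j) ^ 2) +
        ∑ i, a i x * b i x := by
    intro x
    rw [← Finset.sum_add_distrib]
    refine Finset.sum_congr rfl fun i _ => ?_
    rw [hS x i, hA x i]
    ring
  have hAc : Continuous fun x =>
      ∑ i, (∑ j, (Torus.partialDeriv j u x i - Torus.partialDeriv i u x j) / 2 * w x j) ^ 2 := by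
    refine continuous_finsetSum _ fun i _ => ?_
    have : (fun x => ∑ j, (Torus.partialDeriv j u x i - Torus.partialDeriv i u x j) / 2 * w x j) =
        fun x => (a i x - b i x) / 2 := funext fun x => hA x i
    rw [show (fun x => (∑ j, (Torus.partialDeriv j u x i - Torus.partialDeriv i u x j) / 2 * w x j) ^ 2)
        = fun x => ((a i x - b i x) / 2) ^ 2 from funext fun x => by rw [hA x i]]
    exact (((hac i).sub (hbc i)).div_const _).pow 2
  have hPc : Continuous fun x => ∑ i, a i x * b i x :=
    continuous_finsetSum _ fun i _ => (hac i).mul (hbc i)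
  rw [integral_congr_ae (ae_of_all _ hpt),
    integral_add hAc.integrable_unitAddTorus hPc.integrable_unitAddTorus]
  -- it remains to bound `P = ∫ ∑ᵢ aᵢ bᵢ`
  suffices hP : ∫ x, ∑ i, a i x * b i x ≤
      54 * D * Real.sqrt (∫ x, ‖u x‖ ^ 2) * Real.sqrt (Torus.gradNormSq u) by linarith
  -- `D ≥ 0`
  obtain ⟨i₀⟩ : Nonempty d := Fintype.card_pos_iff.1 (by rw [hd]; norm_num)
  have hD0 : 0 ≤ D := (norm_nonneg _).trans (hD (0 : UnitAddTorus d) i₀)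
  -- the scalar components
  have hUk : ∀ k, Torus.IsSmooth (fun y => u y k) := fun k => hu.apply k
  have hGs : ∀ i j, Torus.IsSmooth (fun y => Torus.partialDeriv j u y i) :=
    fun i j => (hu.partialDeriv j).apply i
  have hWs : ∀ j, Torus.IsSmooth (fun y => w y j) := fun j => hw.apply j
  -- expand `P` into the triple sum of `T i j k = ∫ (∂ⱼu)ᵢ wⱼ (∂ᵢu)ₖ wₖ`
  have hexp : ∫ x, ∑ i, a i x * b i x =
      ∑ i, ∑ j, ∑ k, ∫ x, (Torus.partialDeriv j u x i * w x j) * (Torus.partialDeriv i u x k * w x k) := by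
    have e1 : ∀ x, ∑ i, a i x * b i x =
        ∑ i, ∑ j, ∑ k, (Torus.partialDeriv j u x i * w x j) * (Torus.partialDeriv i u x k * w x k) := by
      intro x
      refine Finset.sum_congr rfl fun i _ => ?_
      simp only [ha, hb, Finset.sum_mul_sum]
    rw [integral_congr_ae (ae_of_all _ e1)]
    rw [MeasureTheory.integral_finsetSum _ fun i _ => ?_]
    · refine Finset.sum_congr rfl fun i _ => ?_
      rw [MeasureTheory.integral_finsetSum _ fun j _ => ?_]
      · refine Finset.sum_congr rfl fun j _ => ?_
        rw [MeasureTheory.integral_finsetSum _ fun k _ => ?_]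
        exact (((hDc i j).mul (hwc j)).mul ((hDc k i).mul (hwc k))).integrable_unitAddTorus
      · exact (MeasureTheory.integrable_finsetSum _ fun k _ =>
          (((hDc i j).mul (hwc j)).mul ((hDc k i).mul (hwc k))).integrable_unitAddTorus)
    · exact MeasureTheory.integrable_finsetSum _ fun j _ => MeasureTheory.integrable_finsetSum _ fun k _ =>
        (((hDc i j).mul (hwc j)).mul ((hDc k i).mul (hwc k))).integrable_unitAddTorus
  -- integration by parts in each term: `T i j k = -∫ uₖ ∂ᵢ((∂ⱼu)ᵢ) wⱼ wₖ - ∫ uₖ (∂ⱼu)ᵢ ∂ᵢ(wⱼwₖ)`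
  have hT : ∀ i j k, ∫ x, (Torus.partialDeriv j u x i * w x j) * (Torus.partialDeriv i u x k * w x k) =
      -(∫ x, u x k * (Torus.partialDeriv i (fun y => Torus.partialDeriv j u y i) x * (w x j * w x k))) -
        ∫ x, u x k * (Torus.partialDeriv j u x i *
          Torus.partialDeriv i (fun y => w y j * w y k) x) := by
    intro i j k
    have hWjk : Torus.IsSmooth (fun y => w y j * w y k) := (hWs j).mul (hWs k)
    have hΦ : Torus.IsSmooth (fun y => Torus.partialDeriv j u y i * (w y j * w y k)) :=
      (hGs i j).mul hWjk
    -- `(∂ᵢu)ₖ = ∂ᵢ(uₖ)`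
    have e1 : ∀ x, (Torus.partialDeriv j u x i * w x j) * (Torus.partialDeriv i u x k * w x k) =
        Torus.partialDeriv i (fun y => u y k) x * (Torus.partialDeriv j u x i * (w x j * w x k)) := by
      intro x
      rw [Torus.partialDeriv_apply_coord (hu.isContDiff (by simp)) i x k]
      ring
    rw [integral_congr_ae (ae_of_all _ e1), integral_partialDeriv_mul_eq_neg (hUk k) hΦ i]
    -- product rule inside
    have e2 : ∀ x, Torus.partialDeriv i (fun y => Torus.partialDeriv j u y i * (w y j * w y k)) x =
        Torus.partialDeriv j u x i * Torus.partialDeriv i (fun y => w y j * w y k) x +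
          Torus.partialDeriv i (fun y => Torus.partialDeriv j u y i) x * (w x j * w x k) :=
      fun x => Torus.partialDeriv_mul ((hGs i j).isContDiff (by simp))
        (hWjk.isContDiff (by simp)) i x
    simp_rw [e2, mul_add]
    rw [MeasureTheory.integral_add]
    · ring
    · exact ((hUk k).continuous.mul ((hDc i j).mul
        (hWjk.partialDeriv i).continuous)).integrable_unitAddTorus
    · exact ((hUk k).continuous.mul (((hGs i j).partialDeriv i).continuous.mul
        ((hwc j).mul (hwc k)))).integrable_unitAddTorus
  -- the `∂ᵢ(∂ⱼu)ᵢ` terms cancel after summing over `i` (`∇·u = 0`)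
  have hcancel : ∀ j k, ∑ i, ∫ x, u x k *
      (Torus.partialDeriv i (fun y => Torus.partialDeriv j u y i) x * (w x j * w x k)) = 0 := by
    intro j k
    rw [← MeasureTheory.integral_finsetSum Finset.univ
      (f := fun i x => u x k *
        (Torus.partialDeriv i (fun y => Torus.partialDeriv j u y i) x * (w x j * w x k)))
      fun i _ => ((hUk k).continuous.mul
        (((hGs i j).partialDeriv i).continuous.mul ((hwc j).mul (hwc k)))).integrable_unitAddTorus]
    have e : ∀ x, ∑ i, u x k *
        (Torus.partialDeriv i (fun y => Torus.partialDeriv j u y i) x * (w x j * w x k)) =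
        u x k * (w x j * w x k) * ∑ i, Torus.partialDeriv i (fun y => Torus.partialDeriv j u y i) x := by
      intro x
      rw [Finset.mul_sum]
      exact Finset.sum_congr rfl fun i _ => by ring
    rw [integral_congr_ae (ae_of_all _ e)]
    simp only [sum_partialDeriv_partialDeriv_apply_eq_zero hu hdiv, mul_zero, integral_zero]
  -- hence `P = -∑ᵢⱼₖ ∫ uₖ (∂ⱼu)ᵢ ∂ᵢ(wⱼwₖ)`
  have hPeq : ∫ x, ∑ i, a i x * b i x =
      -∑ i, ∑ j, ∑ k, ∫ x, u x k * (Torus.partialDeriv j u x i *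
        Torus.partialDeriv i (fun y => w y j * w y k) x) := by
    rw [hexp]
    simp only [hT]
    have e : ∀ i j k, -(∫ x, u x k *
        (Torus.partialDeriv i (fun y => Torus.partialDeriv j u y i) x * (w x j * w x k))) -
        ∫ x, u x k * (Torus.partialDeriv j u x i * Torus.partialDeriv i (fun y => w y j * w y k) x) =
        -(∫ x, u x k *
          (Torus.partialDeriv i (fun y => Torus.partialDeriv j u y i) x * (w x j * w x k))) +
        -(∫ x, u x k * (Torus.partialDeriv j u x i *
          Torus.partialDeriv i (fun y => w y j * w y k) x)) := fun i j k => by ring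
    simp only [e, Finset.sum_add_distrib, Finset.sum_neg_distrib]
    have hc : ∑ i, ∑ j, ∑ k, ∫ x, u x k *
        (Torus.partialDeriv i (fun y => Torus.partialDeriv j u y i) x * (w x j * w x k)) = 0 := by
      rw [Finset.sum_comm]
      refine Finset.sum_eq_zero fun j _ => ?_
      rw [Finset.sum_comm]
      exact Finset.sum_eq_zero fun k _ => hcancel j k
    rw [hc, neg_zero, zero_add]
  -- pointwise bound of each remaining integrand by `2D ‖u‖ |∇u|`
  set F : UnitAddTorus d → ℝ := fun x => Real.sqrt (∑ j, ‖Torus.partialDeriv j u x‖ ^ 2) with hF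
  have hFc : Continuous F :=
    Real.continuous_sqrt.comp
      (continuous_finsetSum _ fun j _ => ((hu.partialDeriv j).continuous.norm).pow 2)
  have hF0 : ∀ x, 0 ≤ F x := fun x => Real.sqrt_nonneg _
  have hGle : ∀ x i j, |Torus.partialDeriv j u x i| ≤ F x := by
    intro x i j
    have h1 : |Torus.partialDeriv j u x i| ≤ ‖Torus.partialDeriv j u x‖ := by
      rw [← Real.norm_eq_abs]
      exact PiLp.norm_apply_le (Torus.partialDeriv j u x) i
    refine h1.trans ?_
    rw [hF]
    refine Real.le_sqrt_of_sq_le ?_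
    exact Finset.single_le_sum (f := fun j => ‖Torus.partialDeriv j u x‖ ^ 2)
      (fun _ _ => sq_nonneg _) (Finset.mem_univ j)
  have huk : ∀ x k, |u x k| ≤ ‖u x‖ := fun x k => by
    rw [← Real.norm_eq_abs]; exact PiLp.norm_apply_le (u x) k
  have hwj : ∀ x j, |w x j| ≤ 1 := fun x j => by
    rw [← Real.norm_eq_abs, ← hw1 x]; exact PiLp.norm_apply_le (w x) j
  have hdw : ∀ x i j, |Torus.partialDeriv i (fun y => w y j) x| ≤ D := by
    intro x i j
    rw [Torus.partialDeriv_apply_coord (hw.isContDiff (by simp)) i x j, ← Real.norm_eq_abs]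
    exact (PiLp.norm_apply_le (Torus.partialDeriv i w x) j).trans (hD x i)
  have hdww : ∀ x i j k, |Torus.partialDeriv i (fun y => w y j * w y k) x| ≤ 2 * D := by
    intro x i j k
    rw [Torus.partialDeriv_mul ((hWs j).isContDiff (by simp)) ((hWs k).isContDiff (by simp)) i x]
    calc |w x j * Torus.partialDeriv i (fun y => w y k) x + Torus.partialDeriv i (fun y => w y j) x * w x k|
        ≤ |w x j * Torus.partialDeriv i (fun y => w y k) x| +
            |Torus.partialDeriv i (fun y => w y j) x * w x k| := abs_add_le _ _
      _ = |w x j| * |Torus.partialDeriv i (fun y => w y k) x| +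
            |Torus.partialDeriv i (fun y => w y j) x| * |w x k| := by rw [abs_mul, abs_mul]
      _ ≤ 1 * D + D * 1 :=
          add_le_add (mul_le_mul (hwj x j) (hdw x i k) (abs_nonneg _) zero_le_one)
            (mul_le_mul (hdw x i j) (hwj x k) (abs_nonneg _) hD0)
      _ = 2 * D := by ring
  have hterm : ∀ i j k, |∫ x, u x k * (Torus.partialDeriv j u x i *
      Torus.partialDeriv i (fun y => w y j * w y k) x)| ≤ 2 * D * ∫ x, ‖u x‖ * F x := by
    intro i j k
    have hb : ∀ x, ‖u x k * (Torus.partialDeriv j u x i *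
        Torus.partialDeriv i (fun y => w y j * w y k) x)‖ ≤ 2 * D * (‖u x‖ * F x) := by
      intro x
      rw [Real.norm_eq_abs, abs_mul, abs_mul]
      calc |u x k| * (|Torus.partialDeriv j u x i| * |Torus.partialDeriv i (fun y => w y j * w y k) x|)
          ≤ ‖u x‖ * (F x * (2 * D)) :=
            mul_le_mul (huk x k) (mul_le_mul (hGle x i j) (hdww x i j k) (abs_nonneg _) (hF0 x))
              (by positivity) (norm_nonneg _)
        _ = 2 * D * (‖u x‖ * F x) := by ring
    have hI : Integrable (fun x => 2 * D * (‖u x‖ * F x)) volume :=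
      ((hu.continuous.norm.mul hFc).integrable_unitAddTorus).const_mul _
    rw [← Real.norm_eq_abs]
    refine (norm_integral_le_of_norm_le hI (ae_of_all _ hb)).trans (le_of_eq ?_)
    exact MeasureTheory.integral_const_mul _ _
  -- Cauchy–Schwarz: `∫ ‖u‖ F ≤ ‖u‖₂ ‖∇u‖₂`
  have hCS : ∫ x, ‖u x‖ * F x ≤ Real.sqrt (∫ x, ‖u x‖ ^ 2) * Real.sqrt (Torus.gradNormSq u) := by
    have h := integral_mul_le_sqrt_mul_sqrt hu.continuous.norm hFc (fun x => norm_nonneg _) hF0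
    have hF2 : ∫ x, F x ^ 2 = Torus.gradNormSq u := by
      have e : ∀ x, F x ^ 2 = ∑ j, ‖Torus.partialDeriv j u x‖ ^ 2 := fun x =>
        Real.sq_sqrt (Finset.sum_nonneg fun j _ => sq_nonneg _)
      simp only [e, Torus.gradNormSq]
    rw [hF2] at h
    exact h
  have hIuF : 0 ≤ ∫ x, ‖u x‖ * F x := integral_nonneg fun x => mul_nonneg (norm_nonneg _) (hF0 x)
  -- summation: `27` terms
  rw [hPeq]
  have hcard : (Finset.univ : Finset d).card = 3 := by rw [Finset.card_univ, hd]
  calc -∑ i, ∑ j, ∑ k, ∫ x, u x k * (Torus.partialDeriv j u x i *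
          Torus.partialDeriv i (fun y => w y j * w y k) x)
      ≤ ∑ i, ∑ j, ∑ k, |∫ x, u x k * (Torus.partialDeriv j u x i *
          Torus.partialDeriv i (fun y => w y j * w y k) x)| := by
        rw [← Finset.sum_neg_distrib]
        refine Finset.sum_le_sum fun i _ => ?_
        rw [← Finset.sum_neg_distrib]
        refine Finset.sum_le_sum fun j _ => ?_
        rw [← Finset.sum_neg_distrib]
        exact Finset.sum_le_sum fun k _ => neg_le_abs _
    _ ≤ ∑ i : d, ∑ j : d, ∑ k : d, 2 * D * ∫ x, ‖u x‖ * F x :=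
        Finset.sum_le_sum fun i _ => Finset.sum_le_sum fun j _ => Finset.sum_le_sum fun k _ =>
          hterm i j k
    _ = 54 * D * ∫ x, ‖u x‖ * F x := by
        simp only [Finset.sum_const, hcard, nsmul_eq_mul]
        push_cast
        ring
    _ ≤ 54 * D * (Real.sqrt (∫ x, ‖u x‖ ^ 2) * Real.sqrt (Torus.gradNormSq u)) :=
        mul_le_mul_of_nonneg_left hCS (by positivity)
    _ = 54 * D * Real.sqrt (∫ x, ‖u x‖ ^ 2) * Real.sqrt (Torus.gradNormSq u) := by ring

end AnisotropicVorticity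

open AnisotropicVorticity

/-! ## §3 Miller's Theorem 1.6 on `T³`, continuation form -/

/-- **Miller's locally anisotropic regularity criterion in terms of the vorticity** (PAMS B 8
(2021), Thm 1.6 = Thm 2.1: "`v ∈ L^∞`, `|v(x,t)| = 1` a.e., `∇v ∈ L^∞_loc L^∞_x` … if
`T_max < +∞` then `∫₀^{T_max}‖v × ω‖⁴_{L²} dt = +∞`"), on `T³`, continuation form. Let `(u, p)` be
a classical mean-zero solution of the unforced Navier–Stokes equations with `ν > 0` on
`[0, T) × T^d`, `card d = 3`, `T > 0`; let `w(t, ·)` be, for every `t ∈ [0, T)`, a smooth field of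
unit vectors on `T^d` with `‖∂ᵢw(t,x)‖ ≤ D` for all `t, x, i` ("`∇v ∈ L^∞_tL^∞_x`"); let `N` be a
continuous function on `[0, T)` with
`∫ |A(t,x)w(t,x)|² dx ≤ N(t)²`, `(Aw)ᵢ = ∑ⱼ ½((∂ⱼu)ᵢ − (∂ᵢu)ⱼ)wⱼ` — in three dimensions
`|Aw| = ½|w × ω|`, so this is `½‖w(t) × ω(t)‖_{L²} ≤ N(t)` — and `∫₀ᵗ N⁴ ≤ I` for `t ∈ [0, T)`.
Then the solution continues to a classical mean-zero solution on some `[0, T'] × T^d`, `T' > T`,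
equal to `u` on `[0, T)`. Proof = the printed one with `ν`: (step3) + IBP
(`AnisotropicVorticity.integral_strainDirection_sq_le`) give
`‖S(t)w(t)‖²_{L²} ≤ N(t)² + 54D‖u(t)‖₂‖∇u(t)‖₂ ≤ N² + 54D‖u(0)‖₂‖∇u(t)‖₂` (energy equality
`Torus.IsClassicalNSSolutionOn.energy_eq`), so `M(t) = (N² + 54D‖u₀‖₂√G(t))^{1/2}`,
`G = ‖∇u‖₂²`, is a continuous majorant of `‖S w‖_{L²}`; the strain-in-every-direction flux bound
at `q = 2` (`Torus.exists_enstrophyFlux_le_of_strainDirection_Lq_le`, exponent `2q/(2q−3) = 4`)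
gives `flux ≤ K M⁴ G ≤ K(2N⁴ + 2·54²D²‖u₀‖₂² G)G`, and the Grönwall door closes with
`∫₀ᵗ G ≤ ‖u₀‖₂²/(2ν)` (energy equality again).
[cite: Miller2021Anisotropic, Thm 1.6 (= Thm 2.1) and its proof (§2)] -/
theorem Torus.classicalNS_continuation_of_anisotropicVorticity_sq_integral_le
    (hd : Fintype.card d = 3) {ν T : ℝ} (hν : 0 < ν) (hT : 0 < T)
    {u : ℝ → UnitAddTorus d → EuclideanSpace ℝ d} {p : ℝ → UnitAddTorus d → ℝ}
    (h : Torus.IsClassicalNSSolutionOn (Ico 0 T) ν 0 u p)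
    (hmean : ∀ t ∈ Ico 0 T, Torus.HasZeroMean (u t))
    {w : ℝ → UnitAddTorus d → EuclideanSpace ℝ d} (hws : ∀ t ∈ Ico 0 T, Torus.IsSmooth (w t))
    (hw1 : ∀ t ∈ Ico 0 T, ∀ x, ‖w t x‖ = 1) {D : ℝ}
    (hD : ∀ t ∈ Ico 0 T, ∀ x i, ‖Torus.partialDeriv i (w t) x‖ ≤ D)
    {N : ℝ → ℝ} (hNc : ContinuousOn N (Ico 0 T))
    (hN : ∀ t ∈ Ico 0 T, ∫ x, ∑ i, (∑ j,
      (Torus.partialDeriv j (u t) x i - Torus.partialDeriv i (u t) x j) / 2 * w t x j) ^ 2 ≤ N t ^ 2)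
    {I : ℝ} (hI : ∀ t ∈ Ico 0 T, ∫ τ in (0 : ℝ)..t, N τ ^ 4 ≤ I) :
    ∃ T' : ℝ, T < T' ∧ ∃ (u' : ℝ → UnitAddTorus d → EuclideanSpace ℝ d)
      (p' : ℝ → UnitAddTorus d → ℝ), Torus.IsClassicalNSSolutionOn (Icc 0 T') ν 0 u' p' ∧
        (∀ t ∈ Icc 0 T', Torus.HasZeroMean (u' t)) ∧ ∀ t ∈ Ico 0 T, u' t = u t := by
  obtain ⟨K, hK0, hK⟩ :=
    Torus.exists_enstrophyFlux_le_of_strainDirection_Lq_le (d := d) hd (q := 2) (by norm_num) hν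
  have h0T : (0 : ℝ) ∈ Ico 0 T := ⟨le_rfl, hT⟩
  -- `D ≥ 0`
  obtain ⟨i₀⟩ : Nonempty d := Fintype.card_pos_iff.1 (by rw [hd]; norm_num)
  have hD0 : 0 ≤ D := (norm_nonneg _).trans (hD 0 h0T (0 : UnitAddTorus d) i₀)
  -- energy: `E t = ∫‖u t‖²`, `G t = ‖∇u(t)‖₂²`
  set E₀ : ℝ := ∫ x, ‖u 0 x‖ ^ 2 with hE₀
  have hE₀0 : 0 ≤ E₀ := integral_nonneg fun x => sq_nonneg _
  set G : ℝ → ℝ := fun t => Torus.gradNormSq (u t) with hG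
  have hG0 : ∀ t, 0 ≤ G t := fun t => Torus.gradNormSq_nonneg _
  have hconv : Convex ℝ (Ico (0 : ℝ) T) := convex_Ico 0 T
  have henergy : ∀ t ∈ Ico 0 T,
      2⁻¹ * (∫ x, ‖u t x‖ ^ 2) + ν * ∫ τ in (0 : ℝ)..t, G τ = 2⁻¹ * E₀ := by
    intro t ht
    have he := h.energy_eq hconv ht.1 (fun s hs => ⟨hs.1, lt_of_le_of_lt hs.2 ht.2⟩)
    simp only [Torus.kineticEnergy, Pi.zero_apply, inner_zero_left, integral_zero,
      intervalIntegral.integral_zero, add_zero] at he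
    rw [hE₀]
    exact he
  have hIG0 : ∀ t ∈ Ico 0 T, 0 ≤ ∫ τ in (0 : ℝ)..t, G τ := fun t ht =>
    intervalIntegral.integral_nonneg ht.1 fun τ _ => hG0 τ
  have hEt : ∀ t ∈ Ico 0 T, ∫ x, ‖u t x‖ ^ 2 ≤ E₀ := by
    intro t ht
    have := henergy t ht
    nlinarith [hIG0 t ht, hν]
  have hIG : ∀ t ∈ Ico 0 T, ∫ τ in (0 : ℝ)..t, G τ ≤ E₀ / (2 * ν) := by
    intro t ht
    have := henergy t ht
    have hE : 0 ≤ ∫ x, ‖u t x‖ ^ 2 := integral_nonneg fun x => sq_nonneg _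
    rw [le_div_iff₀ (by positivity)]
    nlinarith
  -- the constant `c = 54 D √E₀` and the majorant `M t = √(N t² + c √(G t))`
  set c : ℝ := 54 * D * Real.sqrt E₀ with hc
  have hc0 : 0 ≤ c := by positivity
  have hGc : ContinuousOn G (Ico 0 T) :=
    h.smooth_velocity.continuousOn_gradNormSq hconv (uniqueDiffOn_Ico 0 T)
  -- the door, with `g t = 2K (2 N⁴ + 2 c² G)`
  refine Torus.classicalNS_continuation_of_enstrophyFlux_le hd hν hT h hmean
    (g := fun t => 2 * K * (2 * N t ^ 4 + 2 * c ^ 2 * G t))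
    (continuousOn_const.mul (((continuousOn_const.mul (hNc.pow 4)).add
      (continuousOn_const.mul hGc)))) (fun t ht => ?_)
    (I := 2 * K * (2 * I + 2 * c ^ 2 * (E₀ / (2 * ν)))) (fun t ht => ?_)
  · -- the flux at time `t`
    have hut : Torus.IsSmooth (u t) := h.smooth_velocity.isSmooth_slice ht
    set Λ : UnitAddTorus d → ℝ := fun x => Real.sqrt (∑ i, (∑ j,
      (Torus.partialDeriv j (u t) x i + Torus.partialDeriv i (u t) x j) / 2 * w t x j) ^ 2) with hΛ
    have hΛc : Continuous Λ := by
      refine Real.continuous_sqrt.comp (continuous_finsetSum _ fun i _ => ?_)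
      refine (continuous_finsetSum _ fun j _ => ?_).pow 2
      exact ((((hut.partialDeriv j).apply i).continuous.add
        ((hut.partialDeriv i).apply j).continuous).div_const _).mul ((hws t ht).apply j).continuous
    have hΛ0 : ∀ x, 0 ≤ Λ x := fun x => Real.sqrt_nonneg _
    -- `∫ Λ² ≤ N² + c √G = M²`
    set Msq : ℝ := N t ^ 2 + c * Real.sqrt (G t) with hMsq
    have hMsq0 : 0 ≤ Msq := by positivity
    have hΛ2 : ∫ x, Λ x ^ (2 : ℝ) ≤ Msq := by
      have e : ∀ x, Λ x ^ (2 : ℝ) = ∑ i, (∑ j,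
          (Torus.partialDeriv j (u t) x i + Torus.partialDeriv i (u t) x j) / 2 * w t x j) ^ 2 := by
        intro x
        rw [Real.rpow_two, hΛ, Real.sq_sqrt (Finset.sum_nonneg fun i _ => sq_nonneg _)]
      simp only [e]
      have h3 := integral_strainDirection_sq_le hd hut (h.divFree t ht) (hws t ht) (hw1 t ht) (hD t ht)
      have hsq : Real.sqrt (∫ x, ‖u t x‖ ^ 2) ≤ Real.sqrt E₀ := Real.sqrt_le_sqrt (hEt t ht)
      have h4 : 54 * D * Real.sqrt (∫ x, ‖u t x‖ ^ 2) * Real.sqrt (Torus.gradNormSq (u t)) ≤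
          c * Real.sqrt (G t) := by
        rw [hc]
        exact mul_le_mul_of_nonneg_right (mul_le_mul_of_nonneg_left hsq (by positivity))
          (Real.sqrt_nonneg _)
      linarith [hN t ht]
    have hM : (∫ x, Λ x ^ (2 : ℝ)) ^ (1 / (2 : ℝ)) ≤ Real.sqrt Msq := by
      rw [Real.sqrt_eq_rpow]
      exact Real.rpow_le_rpow (integral_nonneg fun x => Real.rpow_nonneg (hΛ0 x) _) hΛ2
        (by norm_num)
    have h1 := hK (u t) hut (h.divFree t ht) (w t) (hw1 t ht) Λ hΛc hΛ0 (fun x => le_rfl)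
      (Real.sqrt Msq) (Real.sqrt_nonneg _) hM
    -- `(√Msq)^{4} = Msq² ≤ 2N⁴ + 2c²G`
    have hexp : (2 : ℝ) * 2 / (2 * 2 - 3) = 4 := by norm_num
    rw [hexp, show (4 : ℝ) = ((4 : ℕ) : ℝ) by norm_num, Real.rpow_natCast] at h1
    have hM4 : Real.sqrt Msq ^ 4 = Msq ^ 2 := by
      rw [show (4 : ℕ) = 2 * 2 from rfl, pow_mul, Real.sq_sqrt hMsq0]
    rw [hM4] at h1
    have hMsq2 : Msq ^ 2 ≤ 2 * N t ^ 4 + 2 * c ^ 2 * G t := by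
      rw [hMsq]
      have hsG : Real.sqrt (G t) ^ 2 = G t := Real.sq_sqrt (hG0 t)
      nlinarith [sq_nonneg (N t ^ 2 - c * Real.sqrt (G t)), hsG]
    have hKG : 0 ≤ K * G t := mul_nonneg hK0 (hG0 t)
    have h2 : K * Msq ^ 2 * Torus.gradNormSq (u t) ≤
        2 * K * (2 * N t ^ 4 + 2 * c ^ 2 * G t) * (2⁻¹ * Torus.gradNormSq (u t)) := by
      have : K * Msq ^ 2 * G t ≤ K * (2 * N t ^ 4 + 2 * c ^ 2 * G t) * G t := by
        have := mul_le_mul_of_nonneg_left hMsq2 hKG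
        nlinarith
      simp only [hG] at this
      linarith
    exact h1.trans h2
  · -- the primitive of `g`
    have hN4i : IntervalIntegrable (fun τ => N τ ^ 4) volume 0 t :=
      ((hNc.pow 4).mono (fun s hs => ⟨(uIcc_of_le ht.1 ▸ hs).1,
        lt_of_le_of_lt (uIcc_of_le ht.1 ▸ hs).2 ht.2⟩)).intervalIntegrable
    have hGi : IntervalIntegrable G volume 0 t :=
      (hGc.mono (fun s hs => ⟨(uIcc_of_le ht.1 ▸ hs).1,
        lt_of_le_of_lt (uIcc_of_le ht.1 ▸ hs).2 ht.2⟩)).intervalIntegrable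
    rw [intervalIntegral.integral_const_mul, intervalIntegral.integral_add (hN4i.const_mul _)
      (hGi.const_mul _), intervalIntegral.integral_const_mul, intervalIntegral.integral_const_mul]
    have hK2 : 0 ≤ 2 * K := by positivity
    refine mul_le_mul_of_nonneg_left ?_ hK2
    exact add_le_add (mul_le_mul_of_nonneg_left (hI t ht) (by norm_num))
      (mul_le_mul_of_nonneg_left (hIG t ht) (by positivity))

/-! ## §4 The statement with the cross product `w × ω` on `T³ = UnitAddTorus (Fin 3)` -/

namespace AnisotropicVorticity

/-- Pointwise, in three dimensions: `4|Aw|² = |ω × w|²`, where `(Aw)ᵢ = ∑ⱼ ½((∂ⱼu)ᵢ − (∂ᵢu)ⱼ)wⱼ`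
and `ω = curl u` (Miller 2021, (Av): "`½ v × ω = Av`"). [cite: Miller2021Anisotropic, §2 (Av)] -/
theorem four_mul_sum_antisymDirection_sq_eq (u : UnitAddTorus (Fin 3) → EuclideanSpace ℝ (Fin 3))
    (x : UnitAddTorus (Fin 3)) (w : EuclideanSpace ℝ (Fin 3)) :
    4 * ∑ i, (∑ j, (Torus.partialDeriv j u x i - Torus.partialDeriv i u x j) / 2 * w j) ^ 2 =
      (BDSV.curl u x 1 * w 2 - BDSV.curl u x 2 * w 1) ^ 2 +
        (BDSV.curl u x 2 * w 0 - BDSV.curl u x 0 * w 2) ^ 2 +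
        (BDSV.curl u x 0 * w 1 - BDSV.curl u x 1 * w 0) ^ 2 := by
  simp only [Fin.sum_univ_three, BDSV.curl_apply_zero, BDSV.curl_apply_one, BDSV.curl_apply_two]
  ring

end AnisotropicVorticity

/-- **Miller's Theorem 1.6 on `T³`, with the cross product written out.** Same as
`Torus.classicalNS_continuation_of_anisotropicVorticity_sq_integral_le` on `UnitAddTorus (Fin 3)`,
the hypothesis now reading `‖w(t) × ω(t)‖²_{L²} ≤ 4N(t)²`, i.e. `½‖w × ω‖_{L²} ≤ N`
(`ω = curl u`, `(w × ω)₀ = w₁ω₂ − w₂ω₁` etc.), `∫₀ᵗ N⁴ ≤ I` ⇒ continuation past `T`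
(printed: "`∫₀^{T_max}‖v × ω‖⁴_{L²} = +∞`").
[cite: Miller2021Anisotropic, Thm 1.6 (= Thm 2.1)] -/
theorem Torus.classicalNS_continuation_of_crossProduct_vorticity_sq_integral_le
    {ν T : ℝ} (hν : 0 < ν) (hT : 0 < T)
    {u : ℝ → UnitAddTorus (Fin 3) → EuclideanSpace ℝ (Fin 3)} {p : ℝ → UnitAddTorus (Fin 3) → ℝ}
    (h : Torus.IsClassicalNSSolutionOn (Ico 0 T) ν 0 u p)
    (hmean : ∀ t ∈ Ico 0 T, Torus.HasZeroMean (u t))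
    {w : ℝ → UnitAddTorus (Fin 3) → EuclideanSpace ℝ (Fin 3)}
    (hws : ∀ t ∈ Ico 0 T, Torus.IsSmooth (w t))
    (hw1 : ∀ t ∈ Ico 0 T, ∀ x, ‖w t x‖ = 1) {D : ℝ}
    (hD : ∀ t ∈ Ico 0 T, ∀ x i, ‖Torus.partialDeriv i (w t) x‖ ≤ D)
    {N : ℝ → ℝ} (hNc : ContinuousOn N (Ico 0 T))
    (hN : ∀ t ∈ Ico 0 T, ∫ x, ((w t x 1 * BDSV.curl (u t) x 2 - w t x 2 * BDSV.curl (u t) x 1) ^ 2 +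
      (w t x 2 * BDSV.curl (u t) x 0 - w t x 0 * BDSV.curl (u t) x 2) ^ 2 +
      (w t x 0 * BDSV.curl (u t) x 1 - w t x 1 * BDSV.curl (u t) x 0) ^ 2) ≤ 4 * N t ^ 2)
    {I : ℝ} (hI : ∀ t ∈ Ico 0 T, ∫ τ in (0 : ℝ)..t, N τ ^ 4 ≤ I) :
    ∃ T' : ℝ, T < T' ∧ ∃ (u' : ℝ → UnitAddTorus (Fin 3) → EuclideanSpace ℝ (Fin 3))
      (p' : ℝ → UnitAddTorus (Fin 3) → ℝ), Torus.IsClassicalNSSolutionOn (Icc 0 T') ν 0 u' p' ∧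
        (∀ t ∈ Icc 0 T', Torus.HasZeroMean (u' t)) ∧ ∀ t ∈ Ico 0 T, u' t = u t := by
  refine Torus.classicalNS_continuation_of_anisotropicVorticity_sq_integral_le (d := Fin 3)
    (by simp) hν hT h hmean hws hw1 hD hNc (fun t ht => ?_) hI
  have e : ∀ x, ∑ i, (∑ j,
      (Torus.partialDeriv j (u t) x i - Torus.partialDeriv i (u t) x j) / 2 * w t x j) ^ 2 =
      4⁻¹ * (((w t x 1 * BDSV.curl (u t) x 2 - w t x 2 * BDSV.curl (u t) x 1) ^ 2 +
        (w t x 2 * BDSV.curl (u t) x 0 - w t x 0 * BDSV.curl (u t) x 2) ^ 2 +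
        (w t x 0 * BDSV.curl (u t) x 1 - w t x 1 * BDSV.curl (u t) x 0) ^ 2)) := by
    intro x
    have h4 := AnisotropicVorticity.four_mul_sum_antisymDirection_sq_eq (u t) x (w t x)
    nlinarith [h4]
  rw [integral_congr_ae (ae_of_all _ e), MeasureTheory.integral_const_mul]
  linarith [hN t ht]

end Literature.Analysis.FluidPDE

end
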